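import Mathlib
import Literature.NumberTheory.Transcendental.KZCalculus
import Summits.KontsevichZagierPeriods.KontsevichZagierPeriods.Theorems.TorsionLogsGKZLevelThreePairBetaCubic
import HarnessLib

/-!
# `BetaLinearSector` (stmt-KontsevichZagierPeriods-3897), line `fermat-sector-transport` —
# stub `stub_sixthBeta_equivalent_cubicTail` (the level-6 bridge `B(1/6,1/2) ↦ ∫₁^∞ 3dX/√(X³-1)`)

The LEVEL-6 rung (`a, b, a', b' ∈ ⅙ℤ`) of the crux `BetaLinearSector` (route FermatIsogeny) realises
the CM coincidence `B(1/6,1/2) = √3 · B(1/3,1/2)` INSIDE the Kontsevich–Zagier calculus of moves,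
along the curve `Y² = X³ - 1`.  This file is the bridge from the Beta side to that curve:

* `stub_sixthBeta_equivalent_cubicTail` — ONE change of variables (rule (2)),
  `x = φ(X) = 1/X³` from the half-line `(1, ∞)` onto `(0, 1)` (injective, inverse `X = x^{-1/3}`),
  `φ'(X) = -3X²/(X³)² = -3/X⁴`, and the pull-back identity on `X > 1` (`sixthTail_pullback`; with
  `s = √X`, `t = √(X³-1)` it reads `s⁵ · (s³/t) · (3/s⁸) = 3/t`)

    `φ(X)^{-5/6} · (1 - φ(X))^{-1/2} · |φ'(X)| = X^{5/2} · X^{3/2}(X³-1)^{-1/2} · 3X⁻⁴ = 3/√(X³-1)`,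

  whence `[(1,∞), 3/√(X³-1)] ∼ [(0,1), x^{-5/6}(1-x)^{-1/2}]` (one move) and, by the symmetry of
  `KZ.Equivalent`, `[(0,1), x^{-5/6}(1-x)^{-1/2}] ∼ [(1,∞), 3/√(X³-1)]`.

The map `φ` is `ℚ`-rational without pole on the domain (`isSemialgebraicFunOn_ratFun₁`); the
packaging is the one-dimensional rule (2) `of_sub_of_mem_changeOfVariablesRel_dimOne`, as in the
level-3 template `GKZLevelThree.cubicRational_equivalent_beta`
(`TorsionLogsGKZLevelThreePairBetaCubic.lean`).  Both representations are PINNED by their domain and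
their integrand on it.

## References

* M. Kontsevich, D. Zagier, *Periods* (2001), §1.2 rule (2).
-/

noncomputable section

namespace Summit.KontsevichZagierPeriods.FermatIsogeny.BetaLinearSector.Sixths

open Set MeasureTheory
open MvPolynomial (aeval X C)
open Literature.NumberTheory.Transcendental
open Summit.KontsevichZagierPeriods.HermiteRigidity.CMTwistQuasiPeriodTransfer
  (of_sub_of_mem_changeOfVariablesRel_dimOne image_fin_one)
open Summit.KontsevichZagierPeriods.KontsevichZagierPeriods.Theorems.GKZLevelThree
  (isSemialgebraicFunOn_ratFun₁)

/-! ## The substitution `x = 1/X³` on `(1, ∞)` -/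

/-- The derivative of `φ(X) = (X³)⁻¹` at `X ≠ 0` is `-(3X²)/(X³)²`. [folklore] -/
theorem sixthTail_hasDerivAt_subst {x : ℝ} (hx : x ≠ 0) :
    HasDerivAt (fun y : ℝ => (y ^ 3)⁻¹) (-(3 * x ^ 2) / (x ^ 3) ^ 2) x := by
  have h := (hasDerivAt_pow 3 x).fun_inv (pow_ne_zero 3 hx)
  exact h.congr_deriv (by push_cast; ring)

/-- `φ(X) = (X³)⁻¹` is injective on `[0, ∞)` (cubing is injective on nonnegative reals).
[folklore] -/
theorem sixthTail_subst_injective {p q : ℝ} (hp : 0 ≤ p) (hq : 0 ≤ q)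
    (h : (p ^ 3)⁻¹ = (q ^ 3)⁻¹) : p = q :=
  (pow_left_inj₀ hp hq (by norm_num : (3:ℕ) ≠ 0)).1 (inv_inj.1 h)

/-- For `X > 1`, `φ(X) = (X³)⁻¹ ∈ (0, 1)`. [folklore] -/
theorem sixthTail_subst_mem {y : ℝ} (hy : 1 < y) : (y ^ 3)⁻¹ ∈ Ioo (0:ℝ) 1 :=
  have h1 : (1:ℝ) < y ^ 3 := one_lt_pow₀ hy (by norm_num)
  ⟨inv_pos.2 (one_pos.trans h1), inv_lt_one_of_one_lt₀ h1⟩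

/-- `φ(X) = (X³)⁻¹` maps `(1, ∞)` ONTO `(0, 1)`: for `0 < u < 1`, `X = (u⁻¹)^{1/3} > 1` has
`φ(X) = u`. [folklore] -/
theorem sixthTail_image_subst : (fun y : ℝ => (y ^ 3)⁻¹) '' Ioi 1 = Ioo 0 1 := by
  ext u
  constructor
  · rintro ⟨y, hy, rfl⟩
    exact sixthTail_subst_mem hy
  · rintro ⟨hu0, hu1⟩
    refine ⟨(u⁻¹) ^ ((3:ℕ)⁻¹ : ℝ), ?_, ?_⟩
    · exact Real.one_lt_rpow ((one_lt_inv₀ hu0).2 hu1) (by positivity)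
    · show (((u⁻¹) ^ ((3:ℕ)⁻¹ : ℝ)) ^ 3)⁻¹ = u
      rw [Real.rpow_inv_natCast_pow (inv_pos.2 hu0).le (by norm_num), inv_inv]

/-- The pull-back identity: for `X > 1`,
`((X³)⁻¹)^{-5/6} · (1 - (X³)⁻¹)^{-1/2} · |-(3X²)/(X³)²| = 3/√(X³-1)`
(with `s = √X`, `t = √(X³-1)`: `s⁵ · (s³/t) · (3s⁴/s¹²) = 3/t`). [folklore] -/
theorem sixthTail_pullback {x : ℝ} (hx : 1 < x) :
    ((x ^ 3)⁻¹) ^ (-(5:ℝ) / 6) * (1 - (x ^ 3)⁻¹) ^ (-(1:ℝ) / 2) *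
        |-(3 * x ^ 2) / (x ^ 3) ^ 2| = 3 / Real.sqrt (x ^ 3 - 1) := by
  have hx0 : 0 < x := one_pos.trans hx
  have hx3 : 0 < x ^ 3 - 1 := sub_pos.2 (one_lt_pow₀ hx (by norm_num))
  set s : ℝ := Real.sqrt x with hs
  set t : ℝ := Real.sqrt (x ^ 3 - 1) with ht
  have hs0 : 0 < s := Real.sqrt_pos.2 hx0
  have ht0 : 0 < t := Real.sqrt_pos.2 hx3
  have hsx : s ^ 2 = x := Real.sq_sqrt hx0.le
  have htx : t ^ 2 = x ^ 3 - 1 := Real.sq_sqrt hx3.le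
  have h6 : (6:ℕ) ≠ 0 := by norm_num
  have h2 : (2:ℕ) ≠ 0 := by norm_num
  have hx0' : x ≠ 0 := hx0.ne'
  have hs0' : s ≠ 0 := hs0.ne'
  have ht0' : t ≠ 0 := ht0.ne'
  -- `((X³)⁻¹)^{-5/6} = s⁵`
  have hx6 : x ^ 3 = s ^ 6 := by rw [← hsx]; ring
  have hA : ((x ^ 3)⁻¹) ^ (-(5:ℝ) / 6) = s ^ 5 := by
    rw [hx6, show (-(5:ℝ) / 6) = -(((6:ℕ)⁻¹ : ℝ) * 5) by norm_num, Real.rpow_neg (by positivity),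
      Real.inv_rpow (by positivity), inv_inv, Real.rpow_mul (by positivity),
      Real.pow_rpow_inv_natCast hs0.le h6, Real.rpow_ofNat]
  -- `(1 - (X³)⁻¹)^{-1/2} = s³/t`
  have h1s : 1 - (x ^ 3)⁻¹ = t ^ 2 / (s ^ 3) ^ 2 := by
    have h36 : (s ^ 3) ^ 2 = x ^ 3 := by rw [← hsx]; ring
    have hx3' : x ^ 3 ≠ 0 := pow_ne_zero 3 hx0'
    rw [h36, htx]
    field_simp
  have hB : (1 - (x ^ 3)⁻¹) ^ (-(1:ℝ) / 2) = s ^ 3 / t := by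
    rw [h1s, show (-(1:ℝ) / 2) = -((2:ℕ)⁻¹ : ℝ) by norm_num, Real.rpow_neg (by positivity),
      Real.div_rpow (by positivity) (by positivity), Real.pow_rpow_inv_natCast ht0.le h2,
      Real.pow_rpow_inv_natCast (pow_nonneg hs0.le 3) h2, inv_div]
  -- `|φ'(X)| = 3X²/(X³)²`
  have hC : |-(3 * x ^ 2) / (x ^ 3) ^ 2| = 3 * x ^ 2 / (x ^ 3) ^ 2 := by
    rw [neg_div, abs_neg, abs_of_pos (by positivity)]
  rw [hA, hB, hC, ← hsx]
  field_simp

/-! ## The bridge: `[(0,1), x^{-5/6}(1-x)^{-1/2}] ∼ [(1,∞), 3/√(X³-1)]` -/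

/-- **The level-6 bridge.** `[(0,1), x^{-5/6}(1-x)^{-1/2}] ∼ [(1,∞), 3/√(X³-1)]` (value
`B(1/6,1/2)`): ONE change of variables `x = 1/X³` (rule (2)) carries the tail integral
`[(1,∞), 3/√(X³-1)]` of the curve `Y² = X³ - 1` onto the Beta cell — `ℚ`-rational without pole on
`X > 1`, injective with image `(0,1)`, derivative `-3X²/(X³)²`, pull-back identity
`sixthTail_pullback` — and `KZ.Equivalent` is symmetric. [cite: KontsevichZagier2001, §1.2 rule (2)] -/
theorem stub_sixthBeta_equivalent_cubicTail : ∀ (β T : KZ.IntegralRep 1), β.domain = {x | x 0 ∈ Set.Ioo (0:ℝ) 1} → Set.EqOn β.integrand (fun x => (x 0) ^ (-(5:ℝ) / 6) * (1 - x 0) ^ (-(1:ℝ) / 2)) β.domain → T.domain = {x | 1 < x 0} → Set.EqOn T.integrand (fun x => 3 / Real.sqrt (x 0 ^ 3 - 1)) T.domain → KZ.Equivalent β T := by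
  intro β T hβd hβi hTd hTi
  set φ : ℝ → ℝ := fun y => (y ^ 3)⁻¹ with hφ
  set φ' : ℝ → ℝ := fun y => -(3 * y ^ 2) / (y ^ 3) ^ 2 with hφ'
  have hmem : ∀ p ∈ T.domain, 1 < p 0 := fun p hp => by rw [hTd] at hp; exact hp
  refine KZ.Equivalent.symm (KZ.changeOfVariablesRel_subset_relations
    (of_sub_of_mem_changeOfVariablesRel_dimOne T β φ φ' ?_ ?_ ?_ ?_ ?_))
  · -- semialgebraic: `1/X³`, a `ℚ`-rational function without pole on `X > 1`
    refine isSemialgebraicFunOn_ratFun₁ T.isSemialgebraic_domain 1 (X 0 ^ 3) φ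
      (fun x hx => ?_) (fun x _ => ?_)
    · simp only [map_pow, MvPolynomial.aeval_X]
      exact pow_ne_zero 3 (one_pos.trans (hmem x hx)).ne'
    · simp [hφ]
  · -- derivative
    intro p hp
    exact sixthTail_hasDerivAt_subst (one_pos.trans (hmem p hp)).ne'
  · -- injective
    intro p hp q hq h
    exact sixthTail_subst_injective (zero_le_one.trans (hmem p hp).le)
      (zero_le_one.trans (hmem q hq).le) h
  · -- image `φ '' (1,∞) = (0,1)`
    rw [hβd, hTd]
    exact (image_fin_one sixthTail_image_subst).symm
  · -- integrands
    intro p hp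
    have hp' := hmem p hp
    have hφp : (fun _ : Fin 1 => φ (p 0)) ∈ β.domain := by
      rw [hβd]
      exact sixthTail_subst_mem hp'
    rw [hTi hp, hβi hφp]
    exact (sixthTail_pullback hp').symm

end Summit.KontsevichZagierPeriods.FermatIsogeny.BetaLinearSector.Sixths

end
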